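import Summits.QuantumFields.YangMills.Theorems.BalabanLadderNTClassicalShadowOrbitSoftClosure
import HarnessLib

/-!
# Crux `NT` (stmt-QuantumFields-19353), stub `stub_refpkgT : RefPkgT`: THE CLASSICAL SHADOW, XV — the δ-ROBUST orbit test for clause 3
# (third cumulant): «every ground state δ-close to ONE orbit modulo gauge» ⇒ `|kerK3^η_β(x,y,z) − κ₃,Γ(A; x,y,z)| ≤ 648N²·δ + ε` eventually

Helper file (`--supports stmt-QuantumFields-19353`) of the fleet lead prover of crux `NT` (unit `ym-spine-19353-p1`, GEN 16); sequel of
`…ClassicalShadowOrbitSoft` / `…OrbitSoftClosure` (this generation) and of the exact clause-3 orbit test `…OrbitThree` (p605033),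
`…BoundaryLayerK3` (p614119).

WHY.  GEN 15's kit (j302980) priced clause 3 on the boundary layer of the frustrated `(SU(2), rF)` boxes at `C₃ ≳ 10⁶` (b = 6), through the
exact orbit test `orbitK3_le_of_e3osc[_depthOne]`, whose variational input («ground states = ONE orbit mod gauge») no numerics can certify.
This file is the clause-3 twin of `…OrbitSoftClosure`: with the approximate input «every ground state is δ-close, in the densities at `x, y, z`
seen through `Γ`, to the orbit of ONE configuration `A`» the zero-temperature conditional third cumulant is eventually within `648N²·δ + ε` of the
orbit third cumulant of the density field of `A`, and clause 3 prices the box by `|κ₃,Γ(A)| − 648N²·δ`.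

* §1 `abs_k3_sub_k3_le` — the error budget of the five-term cumulant combination (pure real arithmetic): tolerances `d₁` (means), `d₂` (pairs),
  `d₃` (triple), bounds `B` (means) and `B₂` (pairs) ⇒ `|κ₃ − κ₃'| ≤ d₃ + 3(B₂d₁ + Bd₂) + 6B²d₁`;
* §2 `abs_orbitSum_mul_mul_sub_le_of_nearOrbitModGauge`, `softOrbitSums_dens_mul_mul_of_nearOrbitModGauge` — triple products: tolerance
  `k·108N²·δ`;
* §3 **`eventually_abs_kerK3_sub_orbitK3_le_of_nearOrbit`** — the δ-robust clause-3 orbit test with ONE configuration (`648N²·δ + ε`);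
* §4 **`orbitK3_le_of_e3osc_nearOrbit`** — clause 3 (depth `≥ 1`, any unit `a → 0`, any `ℓ > 0`, constant `C₃`) ⇒
  `|κ₃,Γ(A; x,y,z)| − 648N²·δ ≤ C₃ / min(d_x,d_y,d_z)⁴ / (1 + min(‖y−x‖,‖z−y‖,‖z−x‖))⁸`.

HONEST FRAMING.  Consequences of the registered clauses at fixed lattice geometry as `β → ∞`; δ-closeness, closure and kernel symmetry are
HYPOTHESES; nothing here asserts that such boxes exist; no floor, not AF, not NT, not the seam, not the gap; not Clay.
-/

set_option autoImplicit false

noncomputable section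

open MeasureTheory Filter Topology
open Literature.MathematicalPhysics.QuantumFieldTheory Literature.MathematicalPhysics.QuantumLattice
open Literature.Probability.LatticeModels
open Summit.QuantumFields.YangMills.Cruxes.OSLegsFromFemtoAndGap.DlrCollarTransfer
open Summit.QuantumFields.YangMills.Cruxes.UVSeamRec.BoundaryLawPenetration

namespace Summit.QuantumFields.YangMills.Cruxes.NT.ClassicalShadow

/-! ## §1 The error budget of the third-cumulant combination -/

section Arithmetic

/-- **Error budget of the five-term third cumulant.**  If the means are within `d₁`, the pair moments within `d₂` and the triple moment within
`d₃` of reference values, the kernel-side means and pair moments are bounded by `B`, `B₂`, and the reference means by `B`, then the cumulants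
`κ₃ = T − X·P₂₃ − Y·P₁₃ − Z·P₁₂ + 2XYZ` differ by at most `d₃ + 3(B₂·d₁ + B·d₂) + 6B²·d₁`. [folklore] -/
theorem abs_k3_sub_k3_le {X Y Z P₁₂ P₁₃ P₂₃ T m₁ m₂ m₃ m₁₂ m₁₃ m₂₃ m₁₂₃ B B₂ d₁ d₂ d₃ : ℝ}
    (hX : |X - m₁| ≤ d₁) (hY : |Y - m₂| ≤ d₁) (hZ : |Z - m₃| ≤ d₁)
    (h₁₂ : |P₁₂ - m₁₂| ≤ d₂) (h₁₃ : |P₁₃ - m₁₃| ≤ d₂) (h₂₃ : |P₂₃ - m₂₃| ≤ d₂) (hT : |T - m₁₂₃| ≤ d₃)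
    (bY : |Y| ≤ B) (bZ : |Z| ≤ B) (bm₁ : |m₁| ≤ B) (bm₂ : |m₂| ≤ B) (bm₃ : |m₃| ≤ B)
    (b₁₂ : |P₁₂| ≤ B₂) (b₁₃ : |P₁₃| ≤ B₂) (b₂₃ : |P₂₃| ≤ B₂) :
    |(T - X * P₂₃ - Y * P₁₃ - Z * P₁₂ + 2 * (X * Y * Z)) -
        (m₁₂₃ - m₁ * m₂₃ - m₂ * m₁₃ - m₃ * m₁₂ + 2 * (m₁ * m₂ * m₃))| ≤
      d₃ + 3 * (B₂ * d₁ + B * d₂) + 6 * B ^ 2 * d₁ := by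
  -- `|ab − a'b'| ≤ |a − a'|·|b| + |a'|·|b − b'|` (the tree's `SelfNormalisedSkewness.Negative.abs_mul_sub_mul_le'`, inlined to keep the
  -- import closure inside the classical-shadow series)
  have abs_mul_sub_mul_le' : ∀ a a' b b' : ℝ, |a * b - a' * b'| ≤ |a - a'| * |b| + |a'| * |b - b'| := by
    intro a a' b b'
    have e : a * b - a' * b' = (a - a') * b + a' * (b - b') := by ring
    rw [e]
    calc |(a - a') * b + a' * (b - b')| ≤ |(a - a') * b| + |a' * (b - b')| := abs_add_le _ _
      _ = |a - a'| * |b| + |a'| * |b - b'| := by rw [abs_mul, abs_mul]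
  have hd₁ : 0 ≤ d₁ := (abs_nonneg _).trans hX
  have hd₂ : 0 ≤ d₂ := (abs_nonneg _).trans h₁₂
  have hB : 0 ≤ B := (abs_nonneg _).trans bY
  have hB₂ : 0 ≤ B₂ := (abs_nonneg _).trans b₁₂
  -- the three mixed terms
  have t1 : |X * P₂₃ - m₁ * m₂₃| ≤ B₂ * d₁ + B * d₂ := by
    calc |X * P₂₃ - m₁ * m₂₃| ≤ |X - m₁| * |P₂₃| + |m₁| * |P₂₃ - m₂₃| := abs_mul_sub_mul_le' _ _ _ _
      _ ≤ d₁ * B₂ + B * d₂ := add_le_add (mul_le_mul hX b₂₃ (abs_nonneg _) hd₁) (mul_le_mul bm₁ h₂₃ (abs_nonneg _) hB)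
      _ = B₂ * d₁ + B * d₂ := by ring
  have t2 : |Y * P₁₃ - m₂ * m₁₃| ≤ B₂ * d₁ + B * d₂ := by
    calc |Y * P₁₃ - m₂ * m₁₃| ≤ |Y - m₂| * |P₁₃| + |m₂| * |P₁₃ - m₁₃| := abs_mul_sub_mul_le' _ _ _ _
      _ ≤ d₁ * B₂ + B * d₂ := add_le_add (mul_le_mul hY b₁₃ (abs_nonneg _) hd₁) (mul_le_mul bm₂ h₁₃ (abs_nonneg _) hB)
      _ = B₂ * d₁ + B * d₂ := by ring
  have t3 : |Z * P₁₂ - m₃ * m₁₂| ≤ B₂ * d₁ + B * d₂ := by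
    calc |Z * P₁₂ - m₃ * m₁₂| ≤ |Z - m₃| * |P₁₂| + |m₃| * |P₁₂ - m₁₂| := abs_mul_sub_mul_le' _ _ _ _
      _ ≤ d₁ * B₂ + B * d₂ := add_le_add (mul_le_mul hZ b₁₂ (abs_nonneg _) hd₁) (mul_le_mul bm₃ h₁₂ (abs_nonneg _) hB)
      _ = B₂ * d₁ + B * d₂ := by ring
  -- the product of the three means
  have hYZ : |Y * Z - m₂ * m₃| ≤ 2 * B * d₁ := by
    calc |Y * Z - m₂ * m₃| ≤ |Y - m₂| * |Z| + |m₂| * |Z - m₃| := abs_mul_sub_mul_le' _ _ _ _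
      _ ≤ d₁ * B + B * d₁ := add_le_add (mul_le_mul hY bZ (abs_nonneg _) hd₁) (mul_le_mul bm₂ hZ (abs_nonneg _) hB)
      _ = 2 * B * d₁ := by ring
  have bYZ : |Y * Z| ≤ B * B := by rw [abs_mul]; exact mul_le_mul bY bZ (abs_nonneg _) hB
  have t4 : |X * Y * Z - m₁ * m₂ * m₃| ≤ 3 * B ^ 2 * d₁ := by
    have e1 : X * Y * Z = X * (Y * Z) := by ring
    have e2 : m₁ * m₂ * m₃ = m₁ * (m₂ * m₃) := by ring
    rw [e1, e2]
    calc |X * (Y * Z) - m₁ * (m₂ * m₃)| ≤ |X - m₁| * |Y * Z| + |m₁| * |Y * Z - m₂ * m₃| := abs_mul_sub_mul_le' _ _ _ _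
      _ ≤ d₁ * (B * B) + B * (2 * B * d₁) :=
          add_le_add (mul_le_mul hX bYZ (abs_nonneg _) hd₁) (mul_le_mul bm₁ hYZ (abs_nonneg _) hB)
      _ = 3 * B ^ 2 * d₁ := by ring
  have e : (T - X * P₂₃ - Y * P₁₃ - Z * P₁₂ + 2 * (X * Y * Z)) - (m₁₂₃ - m₁ * m₂₃ - m₂ * m₁₃ - m₃ * m₁₂ + 2 * (m₁ * m₂ * m₃)) =
      (T - m₁₂₃) - (X * P₂₃ - m₁ * m₂₃) - (Y * P₁₃ - m₂ * m₁₃) - (Z * P₁₂ - m₃ * m₁₂) + 2 * (X * Y * Z - m₁ * m₂ * m₃) := by ring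
  rw [e]
  have s1 := abs_sub (T - m₁₂₃ - (X * P₂₃ - m₁ * m₂₃) - (Y * P₁₃ - m₂ * m₁₃) - (Z * P₁₂ - m₃ * m₁₂))
    (-(2 * (X * Y * Z - m₁ * m₂ * m₃)))
  have s2 := abs_sub (T - m₁₂₃ - (X * P₂₃ - m₁ * m₂₃) - (Y * P₁₃ - m₂ * m₁₃)) (Z * P₁₂ - m₃ * m₁₂)
  have s3 := abs_sub (T - m₁₂₃ - (X * P₂₃ - m₁ * m₂₃)) (Y * P₁₃ - m₂ * m₁₃)
  have s4 := abs_sub (T - m₁₂₃) (X * P₂₃ - m₁ * m₂₃)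
  have s5 : |(-(2 * (X * Y * Z - m₁ * m₂ * m₃)))| = 2 * |X * Y * Z - m₁ * m₂ * m₃| := by
    rw [abs_neg, abs_mul, abs_two]
  rw [sub_neg_eq_add] at s1
  rw [s5] at s1
  linarith

end Arithmetic

/-! ## §2 Near an orbit modulo gauge ⇒ orbit sums of TRIPLE products near -/

section Abstract

variable {G : Type} [Group G] {ι : Type} [Fintype ι]

/-- **Near an orbit modulo gauge ⇒ orbit sum of a product of THREE bounded gauge-invariant observables near**, tolerance
`k·(B₁B₂ + (B₁ + B₂)B₃)·δ`. [folklore] -/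
theorem abs_orbitSum_mul_mul_sub_le_of_nearOrbitModGauge (γ : ι → LGConfig 4 G → LGConfig 4 G)
    (hmul : ∀ j : ι, ∃ e : ι ≃ ι, ∀ (k : ι) (U : LGConfig 4 G), ∃ h : Site 4 → G, γ k (γ j U) = gaugeTransformZd h (γ (e k) U))
    (hgauge : ∀ (i : ι) (g : Site 4 → G), ∃ g' : Site 4 → G, ∀ U : LGConfig 4 G, γ i (gaugeTransformZd g U) = gaugeTransformZd g' (γ i U))
    {O₁ O₂ O₃ : LGConfig 4 G → ℝ} (hO₁ : IsZdGaugeInvariant O₁) (hO₂ : IsZdGaugeInvariant O₂) (hO₃ : IsZdGaugeInvariant O₃)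
    {B₁ B₂ B₃ : ℝ} (hB₁ : ∀ U, |O₁ U| ≤ B₁) (hB₂ : ∀ U, |O₂ U| ≤ B₂) (hB₃ : ∀ U, |O₃ U| ≤ B₃)
    (A : LGConfig 4 G) {U : LGConfig 4 G} {δ : ℝ} (j : ι) (g : Site 4 → G)
    (hnear₁ : ∀ i, |O₁ (γ i U) - O₁ (γ i (gaugeTransformZd g (γ j A)))| ≤ δ)
    (hnear₂ : ∀ i, |O₂ (γ i U) - O₂ (γ i (gaugeTransformZd g (γ j A)))| ≤ δ)
    (hnear₃ : ∀ i, |O₃ (γ i U) - O₃ (γ i (gaugeTransformZd g (γ j A)))| ≤ δ) :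
    |∑ i, O₁ (γ i U) * O₂ (γ i U) * O₃ (γ i U) - ∑ i, O₁ (γ i A) * O₂ (γ i A) * O₃ (γ i A)| ≤
      Fintype.card ι * ((B₁ * B₂ + (B₁ + B₂) * B₃) * δ) := by
  have hO : IsZdGaugeInvariant fun V => O₁ V * O₂ V * O₃ V := fun g' V => by
    show O₁ _ * O₂ _ * O₃ _ = O₁ V * O₂ V * O₃ V
    rw [hO₁ g', hO₂ g', hO₃ g']
  rw [← orbitSum_eq_of_oneOrbitModGauge' γ hmul hgauge hO A j g]
  refine abs_sum_sub_sum_le_card_mul fun i => ?_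
  set V := gaugeTransformZd g (γ j A)
  have hδ : 0 ≤ δ := (abs_nonneg _).trans (hnear₁ i)
  have h12 : |O₁ (γ i U) * O₂ (γ i U) - O₁ (γ i V) * O₂ (γ i V)| ≤ (B₁ + B₂) * δ :=
    abs_mul_sub_mul_le_of_near (hB₁ _) (hB₂ _) (hnear₁ i) (hnear₂ i)
  have b12 : |O₁ (γ i U) * O₂ (γ i U)| ≤ B₁ * B₂ := by
    rw [abs_mul]
    exact mul_le_mul (hB₁ (γ i U)) (hB₂ (γ i U)) (abs_nonneg _) ((abs_nonneg _).trans (hB₁ (γ i U)))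
  have e : O₁ (γ i U) * O₂ (γ i U) * O₃ (γ i U) - O₁ (γ i V) * O₂ (γ i V) * O₃ (γ i V) =
      O₁ (γ i U) * O₂ (γ i U) * (O₃ (γ i U) - O₃ (γ i V)) +
        (O₁ (γ i U) * O₂ (γ i U) - O₁ (γ i V) * O₂ (γ i V)) * O₃ (γ i V) := by ring
  calc |O₁ (γ i U) * O₂ (γ i U) * O₃ (γ i U) - O₁ (γ i V) * O₂ (γ i V) * O₃ (γ i V)|
      ≤ |O₁ (γ i U) * O₂ (γ i U) * (O₃ (γ i U) - O₃ (γ i V))| +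
          |(O₁ (γ i U) * O₂ (γ i U) - O₁ (γ i V) * O₂ (γ i V)) * O₃ (γ i V)| := by
        rw [e]; exact abs_add_le _ _
    _ = |O₁ (γ i U) * O₂ (γ i U)| * |O₃ (γ i U) - O₃ (γ i V)| +
          |O₁ (γ i U) * O₂ (γ i U) - O₁ (γ i V) * O₂ (γ i V)| * |O₃ (γ i V)| := by
        congr 1 <;> exact abs_mul _ _
    _ ≤ B₁ * B₂ * δ + (B₁ + B₂) * δ * B₃ :=
        add_le_add (mul_le_mul b12 (hnear₃ i) (abs_nonneg _) ((abs_nonneg _).trans b12))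
          (mul_le_mul h12 (hB₃ _) (abs_nonneg _) ((abs_nonneg _).trans h12))
    _ = (B₁ * B₂ + (B₁ + B₂) * B₃) * δ := by ring

end Abstract

/-! ## §3 The δ-robust clause-3 orbit test with ONE configuration -/

section GroundStates

variable {G : Type} [Group G] [TopologicalSpace G] [IsTopologicalGroup G] [CompactSpace G]
  [MeasurableSpace G] [BorelSpace G] (r : LatticeRep G) {ι : Type} [Fintype ι]

/-- **Soft `h₁₂₃`** (triple products of densities, JOINT witness): tolerance `k·(108N²·δ)`. [folklore] -/
theorem softOrbitSums_dens_mul_mul_of_nearOrbitModGauge (c : Fin 4 → ℤ) (b : ℕ) (η : LGConfig 4 G)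
    (γ : ι → LGConfig 4 G → LGConfig 4 G)
    (hmul : ∀ j : ι, ∃ e : ι ≃ ι, ∀ (k : ι) (U : LGConfig 4 G), ∃ h : Site 4 → G, γ k (γ j U) = gaugeTransformZd h (γ (e k) U))
    (hgauge : ∀ (i : ι) (g : Site 4 → G), ∃ g' : Site 4 → G, ∀ U : LGConfig 4 G, γ i (gaugeTransformZd g U) = gaugeTransformZd g' (γ i U))
    (A : LGConfig 4 G) (x y z : Fin 4 → ℤ) {δ : ℝ}
    (hGS : ∀ ζ ∈ cubeMinimisers G r c b η, ∃ (j : ι) (g : Site 4 → G), ∀ i,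
      |dens G r x (γ i (glueWith (cubeEdges c b) ζ η)) - dens G r x (γ i (gaugeTransformZd g (γ j A)))| ≤ δ ∧
      |dens G r y (γ i (glueWith (cubeEdges c b) ζ η)) - dens G r y (γ i (gaugeTransformZd g (γ j A)))| ≤ δ ∧
      |dens G r z (γ i (glueWith (cubeEdges c b) ζ η)) - dens G r z (γ i (gaugeTransformZd g (γ j A)))| ≤ δ) :
    ∀ ζ ∈ cubeMinimisers G r c b η,
      |∑ i, dens G r x (γ i (glueWith (cubeEdges c b) ζ η)) * dens G r y (γ i (glueWith (cubeEdges c b) ζ η)) *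
            dens G r z (γ i (glueWith (cubeEdges c b) ζ η)) -
          ∑ i, dens G r x (γ i A) * dens G r y (γ i A) * dens G r z (γ i A)| ≤ Fintype.card ι * (108 * r.N ^ 2 * δ) := by
  intro ζ hζ
  obtain ⟨j, g, hj⟩ := hGS ζ hζ
  have h := abs_orbitSum_mul_mul_sub_le_of_nearOrbitModGauge γ hmul hgauge (fun g' U => dens_gaugeTransformZd r g' x U)
    (fun g' U => dens_gaugeTransformZd r g' y U) (fun g' U => dens_gaugeTransformZd r g' z U)
    (CornerPrice.abs_dens_le G r x) (CornerPrice.abs_dens_le G r y) (CornerPrice.abs_dens_le G r z) A j g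
    (fun i => (hj i).1) (fun i => (hj i).2.1) (fun i => (hj i).2.2)
  have e : (6 * (r.N : ℝ) * (6 * r.N) + (6 * r.N + 6 * r.N) * (6 * r.N)) * δ = 108 * r.N ^ 2 * δ := by ring
  rwa [e] at h

variable [Nonempty ι]

/-- **δ-robust clause-3 orbit test with ONE configuration.**  Kernel `γ`-symmetry (on continuous observables), closure of `γ` up to re-indexing
and gauge, gauge normalisation, and δ-closeness of every ground state to the orbit of `A` in the densities at `x, y, z` ⇒ for every `ε > 0`,
eventually in `β`, `|kerK3^η_β(x,y,z) − κ₃,Γ(A; x,y,z)| ≤ 648N²·δ + ε`, where `κ₃,Γ(A; x,y,z)` is the orbit third cumulant of the density field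
of `A` (`M…/k` = orbit means of the single, pair and triple products). [folklore] -/
theorem eventually_abs_kerK3_sub_orbitK3_le_of_nearOrbit (c : Fin 4 → ℤ) (b : ℕ) (η : LGConfig 4 G)
    (γ : ι → LGConfig 4 G → LGConfig 4 G) (hγ : ∀ i, Continuous (γ i))
    (hmul : ∀ j : ι, ∃ e : ι ≃ ι, ∀ (k : ι) (U : LGConfig 4 G), ∃ h : Site 4 → G, γ k (γ j U) = gaugeTransformZd h (γ (e k) U))
    (hgauge : ∀ (i : ι) (g : Site 4 → G), ∃ g' : Site 4 → G, ∀ U : LGConfig 4 G, γ i (gaugeTransformZd g U) = gaugeTransformZd g' (γ i U))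
    (hsymm : ∀ (β : ℝ) (i : ι) (F : LGConfig 4 G → ℝ), Continuous F → kerE G r β c b η (F ∘ γ i) = kerE G r β c b η F)
    (A : LGConfig 4 G) {x y z : Fin 4 → ℤ} {δ : ℝ}
    (hGS : ∀ ζ ∈ cubeMinimisers G r c b η, ∃ (j : ι) (g : Site 4 → G), ∀ i,
      |dens G r x (γ i (glueWith (cubeEdges c b) ζ η)) - dens G r x (γ i (gaugeTransformZd g (γ j A)))| ≤ δ ∧
      |dens G r y (γ i (glueWith (cubeEdges c b) ζ η)) - dens G r y (γ i (gaugeTransformZd g (γ j A)))| ≤ δ ∧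
      |dens G r z (γ i (glueWith (cubeEdges c b) ζ η)) - dens G r z (γ i (gaugeTransformZd g (γ j A)))| ≤ δ)
    {ε : ℝ} (hε : 0 < ε) :
    ∀ᶠ β : ℝ in atTop, |kerK3 G r β c b η x y z -
        ((∑ i, dens G r x (γ i A) * dens G r y (γ i A) * dens G r z (γ i A)) / Fintype.card ι -
          (∑ i, dens G r x (γ i A)) / Fintype.card ι * ((∑ i, dens G r y (γ i A) * dens G r z (γ i A)) / Fintype.card ι) -
          (∑ i, dens G r y (γ i A)) / Fintype.card ι * ((∑ i, dens G r x (γ i A) * dens G r z (γ i A)) / Fintype.card ι) -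
          (∑ i, dens G r z (γ i A)) / Fintype.card ι * ((∑ i, dens G r x (γ i A) * dens G r y (γ i A)) / Fintype.card ι) +
          2 * ((∑ i, dens G r x (γ i A)) / Fintype.card ι * ((∑ i, dens G r y (γ i A)) / Fintype.card ι) *
            ((∑ i, dens G r z (γ i A)) / Fintype.card ι)))| ≤ 648 * r.N ^ 2 * δ + ε := by
  have hk : (0 : ℝ) < Fintype.card ι := Nat.cast_pos.2 Fintype.card_pos
  have hδ : 0 ≤ δ := by
    obtain ⟨ζ, hζ⟩ := cubeMinimisers_nonempty (G := G) (r := r) c b η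
    obtain ⟨j, g, hj⟩ := hGS ζ hζ
    obtain ⟨i⟩ := ‹Nonempty ι›
    exact (abs_nonneg _).trans (hj i).1
  -- the tolerance split: ε = ε' · D
  have hD : 0 < 1 + 3 * (36 * (r.N : ℝ) ^ 2 + 6 * r.N) + 6 * (6 * (r.N : ℝ)) ^ 2 := by positivity
  set ε' : ℝ := ε / (1 + 3 * (36 * (r.N : ℝ) ^ 2 + 6 * r.N) + 6 * (6 * (r.N : ℝ)) ^ 2) with hε'def
  have hε' : 0 < ε' := div_pos hε hD
  have hε'D : ε' * (1 + 3 * (36 * (r.N : ℝ) ^ 2 + 6 * r.N) + 6 * (6 * (r.N : ℝ)) ^ 2) = ε := div_mul_cancel₀ ε hD.ne'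
  -- the soft orbit sums
  have near1 : ∀ w ∈ ({x, y, z} : Finset (Fin 4 → ℤ)), ∀ ζ ∈ cubeMinimisers G r c b η, ∃ (j : ι) (g : Site 4 → G), ∀ i,
      |dens G r w (γ i (glueWith (cubeEdges c b) ζ η)) - dens G r w (γ i (gaugeTransformZd g (γ j A)))| ≤ δ := by
    intro w hw ζ hζ
    obtain ⟨j, g, hj⟩ := hGS ζ hζ
    simp only [Finset.mem_insert, Finset.mem_singleton] at hw
    rcases hw with rfl | rfl | rfl
    · exact ⟨j, g, fun i => (hj i).1⟩
    · exact ⟨j, g, fun i => (hj i).2.1⟩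
    · exact ⟨j, g, fun i => (hj i).2.2⟩
  have near2 : ∀ w ∈ ({x, y, z} : Finset (Fin 4 → ℤ)), ∀ w' ∈ ({x, y, z} : Finset (Fin 4 → ℤ)), ∀ ζ ∈ cubeMinimisers G r c b η,
      ∃ (j : ι) (g : Site 4 → G), ∀ i,
      |dens G r w (γ i (glueWith (cubeEdges c b) ζ η)) - dens G r w (γ i (gaugeTransformZd g (γ j A)))| ≤ δ ∧
      |dens G r w' (γ i (glueWith (cubeEdges c b) ζ η)) - dens G r w' (γ i (gaugeTransformZd g (γ j A)))| ≤ δ := by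
    intro w hw w' hw' ζ hζ
    obtain ⟨j, g, hj⟩ := hGS ζ hζ
    have pick : ∀ v ∈ ({x, y, z} : Finset (Fin 4 → ℤ)), ∀ i,
        |dens G r v (γ i (glueWith (cubeEdges c b) ζ η)) - dens G r v (γ i (gaugeTransformZd g (γ j A)))| ≤ δ := by
      intro v hv i
      simp only [Finset.mem_insert, Finset.mem_singleton] at hv
      rcases hv with rfl | rfl | rfl
      · exact (hj i).1
      · exact (hj i).2.1
      · exact (hj i).2.2
    exact ⟨j, g, fun i => ⟨pick w hw i, pick w' hw' i⟩⟩
  have hx : x ∈ ({x, y, z} : Finset (Fin 4 → ℤ)) := by simp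
  have hy : y ∈ ({x, y, z} : Finset (Fin 4 → ℤ)) := by simp
  have hz : z ∈ ({x, y, z} : Finset (Fin 4 → ℤ)) := by simp
  have sm := fun w (hw : w ∈ ({x, y, z} : Finset (Fin 4 → ℤ))) =>
    softOrbitSums_dens_of_nearOrbitModGauge r c b η γ hmul hgauge A w (near1 w hw)
  have sp := fun w (hw : w ∈ ({x, y, z} : Finset (Fin 4 → ℤ))) w' (hw' : w' ∈ ({x, y, z} : Finset (Fin 4 → ℤ))) =>
    softOrbitSums_dens_mul_of_nearOrbitModGauge r c b η γ hmul hgauge A w w' (near2 w hw w' hw')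
  have st := softOrbitSums_dens_mul_mul_of_nearOrbitModGauge r c b η γ hmul hgauge A x y z hGS
  -- the seven eventually-bounds (means: δ + ε', pairs: 12Nδ + ε', triple: 108N²δ + ε')
  have sy := fun (w : Fin 4 → ℤ) (β : ℝ) (i : ι) => hsymm β i _ (continuous_dens r w)
  have sy2 := fun (w w' : Fin 4 → ℤ) (β : ℝ) (i : ι) => hsymm β i _ ((continuous_dens r w).mul (continuous_dens r w'))
  have eX := eventually_abs_kerE_sub_orbitMean_le r c b η γ (fun i => (continuous_dens r x).comp (hγ i)) (sm x hx) (sy x) hε'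
  have eY := eventually_abs_kerE_sub_orbitMean_le r c b η γ (fun i => (continuous_dens r y).comp (hγ i)) (sm y hy) (sy y) hε'
  have eZ := eventually_abs_kerE_sub_orbitMean_le r c b η γ (fun i => (continuous_dens r z).comp (hγ i)) (sm z hz) (sy z) hε'
  have eXY := eventually_abs_kerE_sub_orbitMean_le r c b η γ (F := fun U => dens G r x U * dens G r y U)
    (fun i => ((continuous_dens r x).mul (continuous_dens r y)).comp (hγ i)) (sp x hx y hy) (sy2 x y) hε'
  have eXZ := eventually_abs_kerE_sub_orbitMean_le r c b η γ (F := fun U => dens G r x U * dens G r z U)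
    (fun i => ((continuous_dens r x).mul (continuous_dens r z)).comp (hγ i)) (sp x hx z hz) (sy2 x z) hε'
  have eYZ := eventually_abs_kerE_sub_orbitMean_le r c b η γ (F := fun U => dens G r y U * dens G r z U)
    (fun i => ((continuous_dens r y).mul (continuous_dens r z)).comp (hγ i)) (sp y hy z hz) (sy2 y z) hε'
  have eXYZ := eventually_abs_kerE_sub_orbitMean_le r c b η γ (F := fun U => dens G r x U * dens G r y U * dens G r z U)
    (fun i => (((continuous_dens r x).mul (continuous_dens r y)).mul (continuous_dens r z)).comp (hγ i)) st
    (fun β i => hsymm β i _ (((continuous_dens r x).mul (continuous_dens r y)).mul (continuous_dens r z))) hε'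
  filter_upwards [eX, eY, eZ, eXY, eXZ, eYZ, eXYZ] with β hX hY hZ hXY hXZ hYZ hXYZ
  -- simplify the tolerances `kδ/k`, `k(12Nδ)/k`, `k(108N²δ)/k`
  have e1 : (Fintype.card ι : ℝ) * δ / Fintype.card ι = δ := by field_simp
  have e2 : (Fintype.card ι : ℝ) * (12 * r.N * δ) / Fintype.card ι = 12 * r.N * δ := by field_simp
  have e3 : (Fintype.card ι : ℝ) * (108 * r.N ^ 2 * δ) / Fintype.card ι = 108 * r.N ^ 2 * δ := by field_simp
  rw [e1] at hX hY hZ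
  rw [e2] at hXY hXZ hYZ
  rw [e3] at hXYZ
  -- a priori bounds
  have bY : |kerE G r β c b η (dens G r y)| ≤ 6 * r.N := BoundaryLaw.abs_kerE_le G r β c b η (CornerPrice.abs_dens_le G r y)
  have bZ : |kerE G r β c b η (dens G r z)| ≤ 6 * r.N := BoundaryLaw.abs_kerE_le G r β c b η (CornerPrice.abs_dens_le G r z)
  have bpair : ∀ w w' : Fin 4 → ℤ, |kerE G r β c b η (fun U => dens G r w U * dens G r w' U)| ≤ 36 * r.N ^ 2 := fun w w' =>
    BoundaryLaw.abs_kerE_le G r β c b η fun U => by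
      rw [abs_mul]
      have h := mul_le_mul (CornerPrice.abs_dens_le G r w U) (CornerPrice.abs_dens_le G r w' U) (abs_nonneg _) (by positivity)
      linarith
  have h := abs_k3_sub_k3_le hX hY hZ hXY hXZ hYZ hXYZ bY bZ (abs_orbitMean_dens_le r γ A x) (abs_orbitMean_dens_le r γ A y)
    (abs_orbitMean_dens_le r γ A z) (bpair x y) (bpair x z) (bpair y z)
  have final : 108 * (r.N : ℝ) ^ 2 * δ + ε' + 3 * (36 * r.N ^ 2 * (δ + ε') + 6 * r.N * (12 * r.N * δ + ε')) +
      6 * (6 * (r.N : ℝ)) ^ 2 * (δ + ε') = 648 * r.N ^ 2 * δ + ε := by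
    rw [← hε'D]; ring
  unfold kerK3
  linarith

end GroundStates

/-! ## §4 The clause-3 price at `1 ≤ depth` -/

section Price

variable {G : Type} [Group G] [TopologicalSpace G] [IsTopologicalGroup G] [CompactSpace G]
  [MeasurableSpace G] [BorelSpace G] (r : LatticeRep G) (a : ℝ → ℝ) {ι : Type} [Fintype ι] [Nonempty ι]

/-- **Clause 3 prices a box whose ground states are δ-close to one orbit by the orbit third cumulant of ONE configuration minus `648N²·δ`**, at
any three cube sites (boundary layer included):
`|κ₃,Γ(A; x,y,z)| − 648N²·δ ≤ C₃ / min(d_x,d_y,d_z)⁴ / (1 + min(‖y−x‖,‖z−y‖,‖z−x‖))⁸`. [folklore] -/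
theorem orbitK3_le_of_e3osc_nearOrbit (ha0 : Tendsto a atTop (𝓝 0)) {C₃ ℓ : ℝ} (hℓ : 0 < ℓ)
    (hE3 : ∃ β₃ : ℝ, ∀ β : ℝ, β₃ ≤ β → ∀ (c : Fin 4 → ℤ) (b : ℕ), (b : ℝ) * a β ≤ ℓ →
      ∀ (η η' : LGConfig 4 G) (x y z : Fin 4 → ℤ), 1 ≤ depth c b x → 1 ≤ depth c b y → 1 ≤ depth c b z →
        |kerK3 G r β c b η x y z - kerK3 G r β c b η' x y z| ≤
          C₃ / ((min (min (depth c b x) (depth c b y)) (depth c b z) : ℕ) : ℝ) ^ 4 /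
            (1 + min (min ‖siteToE (y - x)‖ ‖siteToE (z - y)‖) ‖siteToE (z - x)‖) ^ 8)
    (c : Fin 4 → ℤ) (b : ℕ) (η : LGConfig 4 G) (γ : ι → LGConfig 4 G → LGConfig 4 G) (hγ : ∀ i, Continuous (γ i))
    (hmul : ∀ j : ι, ∃ e : ι ≃ ι, ∀ (k : ι) (U : LGConfig 4 G), ∃ h : Site 4 → G, γ k (γ j U) = gaugeTransformZd h (γ (e k) U))
    (hgauge : ∀ (i : ι) (g : Site 4 → G), ∃ g' : Site 4 → G, ∀ U : LGConfig 4 G, γ i (gaugeTransformZd g U) = gaugeTransformZd g' (γ i U))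
    (hsymm : ∀ (β : ℝ) (i : ι) (F : LGConfig 4 G → ℝ), Continuous F → kerE G r β c b η (F ∘ γ i) = kerE G r β c b η F)
    (A : LGConfig 4 G) {x y z : Fin 4 → ℤ} (hx : 1 ≤ depth c b x) (hy : 1 ≤ depth c b y) (hz : 1 ≤ depth c b z) {δ : ℝ}
    (hGS : ∀ ζ ∈ cubeMinimisers G r c b η, ∃ (j : ι) (g : Site 4 → G), ∀ i,
      |dens G r x (γ i (glueWith (cubeEdges c b) ζ η)) - dens G r x (γ i (gaugeTransformZd g (γ j A)))| ≤ δ ∧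
      |dens G r y (γ i (glueWith (cubeEdges c b) ζ η)) - dens G r y (γ i (gaugeTransformZd g (γ j A)))| ≤ δ ∧
      |dens G r z (γ i (glueWith (cubeEdges c b) ζ η)) - dens G r z (γ i (gaugeTransformZd g (γ j A)))| ≤ δ) :
    |(∑ i, dens G r x (γ i A) * dens G r y (γ i A) * dens G r z (γ i A)) / Fintype.card ι -
          (∑ i, dens G r x (γ i A)) / Fintype.card ι * ((∑ i, dens G r y (γ i A) * dens G r z (γ i A)) / Fintype.card ι) -
          (∑ i, dens G r y (γ i A)) / Fintype.card ι * ((∑ i, dens G r x (γ i A) * dens G r z (γ i A)) / Fintype.card ι) -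
          (∑ i, dens G r z (γ i A)) / Fintype.card ι * ((∑ i, dens G r x (γ i A) * dens G r y (γ i A)) / Fintype.card ι) +
          2 * ((∑ i, dens G r x (γ i A)) / Fintype.card ι * ((∑ i, dens G r y (γ i A)) / Fintype.card ι) *
            ((∑ i, dens G r z (γ i A)) / Fintype.card ι))| - 648 * r.N ^ 2 * δ ≤
      C₃ / ((min (min (depth c b x) (depth c b y)) (depth c b z) : ℕ) : ℝ) ^ 4 /
        (1 + min (min ‖siteToE (y - x)‖ ‖siteToE (z - y)‖) ‖siteToE (z - x)‖) ^ 8 := by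
  obtain ⟨β₃, H3⟩ := hE3
  refine le_of_forall_pos_le_add fun e he => ?_
  have he2 : 0 < e / 2 := half_pos he
  have h0 : ∀ᶠ β : ℝ in atTop, |kerK3 G r β c b 1 x y z| ≤ e / 2 := by
    have h := (tendsto_kerK3_one_all r c b x y z).abs
    rw [abs_zero] at h
    exact (h.eventually (eventually_le_nhds he2)).mono fun _ h => h
  have hsoft := eventually_abs_kerK3_sub_orbitK3_le_of_nearOrbit r c b η γ hγ hmul hgauge hsymm A hGS he2
  obtain ⟨β, hβ0, hβs, hb, hβ3⟩ := (h0.and (hsoft.and ((eventually_mul_le_of_tendsto_zero ha0 hℓ b).and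
    (eventually_ge_atTop β₃)))).exists
  have hosc := H3 β hβ3 c b hb η 1 x y z hx hy hz
  set K : ℝ := (∑ i, dens G r x (γ i A) * dens G r y (γ i A) * dens G r z (γ i A)) / Fintype.card ι -
          (∑ i, dens G r x (γ i A)) / Fintype.card ι * ((∑ i, dens G r y (γ i A) * dens G r z (γ i A)) / Fintype.card ι) -
          (∑ i, dens G r y (γ i A)) / Fintype.card ι * ((∑ i, dens G r x (γ i A) * dens G r z (γ i A)) / Fintype.card ι) -
          (∑ i, dens G r z (γ i A)) / Fintype.card ι * ((∑ i, dens G r x (γ i A) * dens G r y (γ i A)) / Fintype.card ι) +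
          2 * ((∑ i, dens G r x (γ i A)) / Fintype.card ι * ((∑ i, dens G r y (γ i A)) / Fintype.card ι) *
            ((∑ i, dens G r z (γ i A)) / Fintype.card ι)) with hK
  have t1 := (abs_sub_abs_le_abs_sub K (kerK3 G r β c b η x y z)).trans_eq (abs_sub_comm K (kerK3 G r β c b η x y z))
  have t2 := abs_sub_abs_le_abs_sub (kerK3 G r β c b η x y z) (kerK3 G r β c b 1 x y z)
  linarith

end Price

end Summit.QuantumFields.YangMills.Cruxes.NT.ClassicalShadow

end
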